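import Literature.NumberTheory.EllipticCurves.NewformRankinSelbergTraceSquarefreeZeta
import Literature.NumberTheory.EllipticCurves.CuspFormSymmSquareLSeries
import HarnessLib

/-!
# The completed trace zeta function of a newform of squarefree level and the naive
# symmetric-square `L`-series

Topic `NumberTheory/EllipticCurves`; namespace `Literature.NumberTheory.EllipticCurves.ModularForms`.
Proof file (theorems only; no definition, no named fact). It joins
`NewformRankinSelbergTraceSquarefreeZeta` (`Z_f(s) = s(s−1)π^{-s}Γ(s)ζ(2s)Γ(s+1)(4π/N)^{-(s+1)}
· (N⁻¹Σ_{c∣N} c^{-s}) · Σₙ|aₙ|²n^{-(s+1)}` for squarefree `N`, `Re s > 1`) to the tree's naive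
symmetric-square series `L^{naive}(Sym² f, u) = Σ symmSqCoeff f n · n^{-u}
= ζ⁽ᴺ⁾(2u−2) ζ⁽ᴺ⁾(u−1)⁻¹ Σ|aₙ|²n^{-u}` (`CuspFormSymmSquareLSeries`, [Bump1997], (6.21)):

* `LSeries_normSq_cuspCoeff_eq_symmSq` — for every `f ∈ S₂(Γ₀(N))` and `Re u > 2`,
  `Σ |aₙ|² n^{-u} = L^{naive}(Sym² f, u) · L(χ₀, u−1) / L(χ₀, 2u−2)` (`χ₀` the trivial character
  mod `N`; Mathlib's `L(χ₀,·) L(χ₀μ,·) = 1`);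
* **`IsNewform0.traceZeta_eq_symmSq_of_squarefree`** — for squarefree `N`, a newform `f` and
  `Re s > 1`:
  `Z_f(s) = s(s−1) π^{-s}Γ(s)ζ(2s)Γ(s+1)(4π/N)^{-(s+1)} · (N⁻¹Σ_{c∣N}c^{-s}) · L(χ₀, s) L(χ₀, 2s)⁻¹
  · L^{naive}(Sym² f, s+1)`.

For the newform of a SEMISTABLE elliptic curve `E/ℚ` (`N` squarefree) `L^{naive}(Sym² f_E, s+1)`
is the motivic `L(Sym² E, s+1)` ([Watkins2004], §1), and on the real segment `1/2 < σ < 1` every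
other factor is finite and non-zero except possibly `ζ(σ)` inside `L(χ₀, σ) = ζ(σ)∏_{p∣N}(1−p^{-σ})`
(classically `ζ(σ) < 0` there): the zero-free hypothesis of
`IsNewform0.petersson_lower_bound_of_zeroFree` (`NewformPeterssonSizeSiegelProofs`) is thus, for
semistable curves, precisely the absence of a real zero of (the continuation of) `L(Sym² E, s)`
near `s = 2` — the theorem of Goldfeld–Hoffstein–Lieman (appendix to [HoffsteinLockhart1994]),
which is not in the tree.

## References

* [Bump1997] D. Bump, *Automorphic Forms and Representations*, CUP 1997, §1.6, (6.21), PDF p. 72.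
* [Rankin1939] R. A. Rankin, Proc. Cambridge Philos. Soc. 35 (1939), §4.
* [Watkins2004] M. Watkins, arXiv:math/0408126, §1.
* [HoffsteinLockhart1994] J. Hoffstein, P. Lockhart (appendix by D. Goldfeld, J. Hoffstein,
  D. Lieman), Ann. of Math. 140 (1994).
-/

noncomputable section

namespace Literature.NumberTheory.EllipticCurves.ModularForms

open Literature.NumberTheory.Automorphic
open _root_.MeasureTheory Set Filter Complex ModularForm CongruenceSubgroup
open UpperHalfPlane hiding I
open scoped Topology MatrixGroups ModularForm

variable {N : ℕ} [NeZero N]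

/-- **`Σ |aₙ|² n^{-u} = L^{naive}(Sym² f, u) · L(χ₀, u−1)/L(χ₀, 2u−2)`** for `f ∈ S₂(Γ₀(N))` and
`Re u > 2` (`LSeries_symmSqCoeff`, `LSeries_symmSqTwist`, and `L(χ₀,·)L(χ₀μ,·) = 1`).
[cite: Bump1997, §1.6 (6.21), PDF p. 72] -/
theorem LSeries_normSq_cuspCoeff_eq_symmSq (f : CuspForm (Gamma0 N) 2) {u : ℂ} (hu : 2 < u.re) :
    LSeries (fun n ↦ (((‖cuspCoeff f n‖ ^ 2 : ℝ)) : ℂ)) u =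
      LSeries (symmSqCoeff f) u * LSeries (fun n : ℕ ↦ (1 : DirichletCharacter ℂ N) n) (u - 1) /
        LSeries (fun n : ℕ ↦ (1 : DirichletCharacter ℂ N) n) (2 * u - 2) := by
  have hu1 : 1 < (u - 1).re := by simp only [sub_re, one_re]; linarith
  have hu2 : 1 < (2 * u - 2).re := by
    simp only [sub_re, mul_re, re_ofNat, im_ofNat, zero_mul, sub_zero]; linarith
  have hsym := LSeries_symmSqCoeff f hu
  have htw := LSeries_symmSqTwist (N := N) hu
  have hmu := DirichletCharacter.LSeries.mul_mu_eq_one (1 : DirichletCharacter ℂ N) hu1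
  have hne2 : LSeries (fun n : ℕ ↦ (1 : DirichletCharacter ℂ N) n) (2 * u - 2) ≠ 0 :=
    DirichletCharacter.LSeries_ne_zero_of_one_lt_re _ hu2
  set A := LSeries (fun n ↦ (((‖cuspCoeff f n‖ ^ 2 : ℝ)) : ℂ)) u
  set M := LSeries ((fun n : ℕ ↦ (1 : DirichletCharacter ℂ N) n) * fun n : ℕ ↦
    ((ArithmeticFunction.moebius n : ℤ) : ℂ)) (u - 1) with hM
  have hmu' : LSeries (fun n : ℕ ↦ (1 : DirichletCharacter ℂ N) n) (u - 1) * M = 1 := hmu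
  rw [hsym, htw, eq_div_iff hne2]
  calc A * LSeries (fun n : ℕ ↦ (1 : DirichletCharacter ℂ N) n) (2 * u - 2)
      = A * LSeries (fun n : ℕ ↦ (1 : DirichletCharacter ℂ N) n) (2 * u - 2) *
          (LSeries (fun n : ℕ ↦ (1 : DirichletCharacter ℂ N) n) (u - 1) * M) := by
        rw [hmu', mul_one]
    _ = _ := by ring

/-- **The completed trace zeta function of a newform of squarefree level and `L^{naive}(Sym² f)`**:
for squarefree `N`, a newform `f ∈ S₂(Γ₀(N))` and `Re s > 1`,
`s(s−1)∫_𝒟 G_f E₀*(·,s)dμ + ½∫_𝒟 G_f dμ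
 = s(s−1)π^{-s}Γ(s)ζ(2s)Γ(s+1)(4π/N)^{-(s+1)} · (N⁻¹Σ_{c∣N}c^{-s}) · (L^{naive}(Sym² f, s+1) L(χ₀, s)/L(χ₀, 2s))`
(`IsNewform0.traceZeta_eq_of_squarefree` and `LSeries_normSq_cuspCoeff_eq_symmSq` at `u = s+1`).
[cite: Rankin1939, §4.4; Bump1997, §1.6 (6.21)] -/
theorem IsNewform0.traceZeta_eq_symmSq_of_squarefree (hN : Squarefree N) {f : CuspForm (Gamma0 N) 2}
    (hf : IsNewform0 f) {s : ℂ} (hs : 1 < s.re) :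
    s * (s - 1) * (∫ w in ModularGroup.fd, (rsTrace N 2 f w : ℂ) * completedEisenstein₀ w s) +
        (((∫ w in ModularGroup.fd, rsTrace N 2 f w : ℝ)) : ℂ) / 2 =
      s * (s - 1) * ((Real.pi : ℂ) ^ (-s) * Complex.Gamma s * riemannZeta (2 * s) *
          (Complex.Gamma (s + 1) * (((4 * Real.pi / N : ℝ)) : ℂ) ^ (-(s + 1)))) *
        (((N : ℂ)⁻¹ * ∑ c ∈ N.divisors, (c : ℂ) ^ (-s)) *
          (LSeries (symmSqCoeff f) (s + 1) * LSeries (fun n : ℕ ↦ (1 : DirichletCharacter ℂ N) n) s /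
            LSeries (fun n : ℕ ↦ (1 : DirichletCharacter ℂ N) n) (2 * s))) := by
  have hu : 2 < (s + 1).re := by simp only [add_re, one_re]; linarith
  rw [hf.traceZeta_eq_of_squarefree hN hs, LSeries_normSq_cuspCoeff_eq_symmSq f hu,
    show s + 1 - 1 = s by ring, show 2 * (s + 1) - 2 = 2 * s by ring]

end Literature.NumberTheory.EllipticCurves.ModularForms

end
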